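import Summits.Ventures.Crystal3D.Theorems.StickyWulffConstantPolycrystalWulffBoundMergingCalculus
import Summits.Ventures.Crystal3D.Theorems.StickyWulffConstantPolycrystalWulffBoundIntersectionBody

/-!
# `PolycrystalWulffBound`: the BLOCK (merged-class, intersection-body) second pincer
# (line `PolyDensity`, crux `stmt-Ventures-19482`)

Route `StickyWulffConstant` of the venture `Summits/Ventures/Crystal3D`, second prover lane (poly-p2,
gen 3).  The common generalisation of the second pincer of `rung_fineTwinFree_third` (blocks = lattice
classes, block bodies = the class's Wulff body) and of the intersection-body bound
`wulff_inter_le_freeEnergy` (one block, body inside every grain body):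

**`block_wulff_le_freeEnergy`** — for pairwise disjoint polyhedral grains `G_f` of finite perimeter and
finite volume with origin-symmetric compact convex bodies `K_f ∋ 0`, any labelling `blk : Fin n → β` of
the grains by blocks, and block bodies `KB b ∋ 0` (origin-symmetric compact convex, `KB b ⊆ B̄(0, R_b)`)
with `KB (blk f) ⊆ K_f`:

  `Σ_b 3·|KB b|^{1/3}·|E_b|^{2/3} − Σ_f Σ_g [blk g ≠ blk f] R_{blk f} · ι_B(G f, G g) ≤ Fr(K)`,

`E_b = ⋃ {G f : blk f = b}`, `ι_B` the Euclidean interface, `Fr(K) = Σ_f [per K_f (G f) − Σ_{g≠f} ι_{K_f}(G f, G g)]`.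
(Free energy is monotone in the bodies; a block's free energy is that of the merged block; Wulff's
inequality for `KB b`; the block's interfaces are over-counted by at most `h_{KB b} ≤ R_b`.)  Every
«K-group» bound of the middle-band LP (poly-p2/MIDDLE-BAND.md) is an instance.
WHAT THIS IS NOT: a rung; walls are not used; F-C1 not moved.
-/

noncomputable section

namespace Summit.Ventures.Crystal3D.Theorems

open MeasureTheory Set Metric
open scoped RealInnerProductSpace ENNReal Pointwise
open Summit.Ventures.Crystal3D.Cruxes.TextureLiminf.TexShadow
open Literature.Analysis.Convexity
open Literature.MathematicalPhysics.StatisticalMechanics (perimeter HasFinitePerimeter)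

/-- **Block second pincer.**  See the module docstring. -/
theorem block_wulff_le_freeEnergy {n : ℕ} (G : Fin n → Set E3)
    (hfin : ∀ f, HasFinitePerimeter (G f) ∧ volume (G f) < ⊤)
    (hPoly : ∀ f, ∃ (k : ℕ) (H : Fin k → Finset (E3 × ℝ)), G f = ⋃ i, polytope (H i))
    (hdisjG : ∀ f g, f ≠ g → Disjoint (G f) (G g))
    (Kf : Fin n → Set E3) (hKc : ∀ f, IsCompact (Kf f)) (hKv : ∀ f, Convex ℝ (Kf f))
    (hK0 : ∀ f, (0 : E3) ∈ Kf f) (hKs : ∀ f, -Kf f = Kf f)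
    {β : Type*} [DecidableEq β] (blk : Fin n → β) (KB : β → Set E3)
    (hBc : ∀ b, IsCompact (KB b)) (hBv : ∀ b, Convex ℝ (KB b)) (hB0 : ∀ b, (0 : E3) ∈ KB b)
    (hBs : ∀ b, -KB b = KB b) (R : β → ℝ) (hR : ∀ b, 0 < R b)
    (hBR : ∀ b, KB b ⊆ closedBall (0 : E3) (R b)) (hsub : ∀ f, KB (blk f) ⊆ Kf f) :
    (∑ b ∈ Finset.univ.image blk, 3 * (volume (KB b)).toReal ^ ((1 : ℝ) / 3) *
        (volume (⋃ f ∈ Finset.univ.filter (fun f => blk f = b), G f)).toReal ^ ((2 : ℝ) / 3)) -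
      ∑ f, ∑ g, (if blk g = blk f then 0 else R (blk f) *
        ((per (closedBall (0 : E3) 1) (G f) + per (closedBall (0 : E3) 1) (G g) -
          per (closedBall (0 : E3) 1) (G f ∪ G g)) / 2)) ≤
      ∑ f, (per (Kf f) (G f) - ∑ g, (if f = g then 0 else
        (per (Kf f) (G f) + per (Kf f) (G g) - per (Kf f) (G f ∪ G g)) / 2)) := by
  classical
  have hvol : ∀ f, volume (G f) < ⊤ := fun f => (hfin f).2
  set L : Finset β := Finset.univ.image blk with hL
  have hmaps : ∀ f ∈ (Finset.univ : Finset (Fin n)), blk f ∈ L := fun f _ =>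
    Finset.mem_image_of_mem blk (Finset.mem_univ f)
  -- the block bodies, grain by grain
  set Kf' : Fin n → Set E3 := fun f => KB (blk f) with hKf'
  -- step 1: monotonicity in the bodies
  have hmono := freeEnergy_mono G hPoly hvol hdisjG Kf hKc hKv hK0 hKs Kf' (fun f => hBc _)
    (fun f => hBv _) (fun f => hB0 _) (fun f => hBs _) hsub
  refine le_trans ?_ hmono
  -- the unit ball and the Euclidean interface terms `w`
  have hB1c : IsCompact (closedBall (0 : E3) 1) := isCompact_closedBall 0 1
  have hB1v : Convex ℝ (closedBall (0 : E3) 1) := convex_closedBall 0 1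
  have hB10 : (0 : E3) ∈ closedBall (0 : E3) 1 := mem_closedBall_self zero_le_one
  set w : Fin n → Fin n → ℝ := fun f g => if f = g then 0 else
    (per (closedBall (0 : E3) 1) (G f) + per (closedBall (0 : E3) 1) (G g) -
      per (closedBall (0 : E3) 1) (G f ∪ G g)) / 2 with hw
  -- one common refinement: interface terms are cross sums, monotone in the body
  obtain ⟨k, H, ν, S, SX, hcross, -, -⟩ := exists_exterior_crossSums G hPoly hvol hdisjG
  have hιle : ∀ b f g, f ≠ g →
      per (KB b) (G f) + per (KB b) (G g) - per (KB b) (G f ∪ G g) ≤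
        R b * (per (closedBall (0 : E3) 1) (G f) + per (closedBall (0 : E3) 1) (G g) -
          per (closedBall (0 : E3) 1) (G f ∪ G g)) := by
    intro b f g hfg
    have hRc : IsCompact (closedBall (0 : E3) (R b)) := isCompact_closedBall 0 _
    have hRv : Convex ℝ (closedBall (0 : E3) (R b)) := convex_closedBall 0 _
    have hR0 : (0 : E3) ∈ closedBall (0 : E3) (R b) := mem_closedBall_self (hR b).le
    have h1 := hcross (KB b) (hBc b) (hBv b) (hB0 b) f g hfg
    have h2 := hcross (closedBall (0 : E3) (R b)) hRc hRv hR0 f g hfg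
    have hm := crossSum_mono (hBR b) isBounded_closedBall ⟨0, hB0 b⟩ H ν (S f) (S g)
    rw [← h1, ← h2, per_closedBall_eq_mul_perimeter (hR b), per_closedBall_eq_mul_perimeter (hR b),
      per_closedBall_eq_mul_perimeter (hR b)] at hm
    rw [per_closedBall_eq_mul_perimeter one_pos, per_closedBall_eq_mul_perimeter one_pos,
      per_closedBall_eq_mul_perimeter one_pos]
    linarith
  -- facts on the merged blocks
  have hfacts : ∀ b, MeasurableSet (⋃ f ∈ Finset.univ.filter (fun f => blk f = b), G f) ∧
      volume (⋃ f ∈ Finset.univ.filter (fun f => blk f = b), G f) < ⊤ ∧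
      perimeter (⋃ f ∈ Finset.univ.filter (fun f => blk f = b), G f) ≠ ⊤ ∧
      (volume (⋃ f ∈ Finset.univ.filter (fun f => blk f = b), G f)).toReal =
        ∑ f ∈ Finset.univ.filter (fun f => blk f = b), (volume (G f)).toReal :=
    fun b => subfamily_union_facts G hfin hdisjG _
  -- block by block
  have hblock : ∀ b ∈ L, 3 * (volume (KB b)).toReal ^ ((1 : ℝ) / 3) *
      (volume (⋃ f ∈ Finset.univ.filter (fun f => blk f = b), G f)).toReal ^ ((2 : ℝ) / 3) -
      (∑ f ∈ Finset.univ.filter (fun f => blk f = b),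
        ∑ g, (if blk g = blk f then 0 else R (blk f) * w f g)) ≤
      ∑ f ∈ Finset.univ.filter (fun f => blk f = b),
        (per (Kf' f) (G f) - ∑ g, (if f = g then 0 else
          (per (Kf' f) (G f) + per (Kf' f) (G g) - per (Kf' f) (G f ∪ G g)) / 2)) := by
    intro b _
    set K : Set E3 := KB b with hK
    have hKf : ∀ f ∈ Finset.univ.filter (fun f => blk f = b), Kf' f = K := fun f hf => by
      simp only [hKf', hK, (Finset.mem_filter.1 hf).2]
    have hX : (∑ f ∈ Finset.univ.filter (fun f => blk f = b),
        (per (Kf' f) (G f) - ∑ g, (if f = g then 0 else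
          (per (Kf' f) (G f) + per (Kf' f) (G g) - per (Kf' f) (G f ∪ G g)) / 2))) =
        ∑ f ∈ Finset.univ.filter (fun f => blk f = b),
          (per K (G f) - ∑ g, (if f = g then 0 else
            (per K (G f) + per K (G g) - per K (G f ∪ G g)) / 2)) :=
      Finset.sum_congr rfl fun f hf => by rw [hKf f hf]
    rw [hX, freeEnergy_class_eq_merged G hPoly hvol hdisjG (hBc b) (hBv b) (hB0 b) (hBs b) _]
    -- Wulff's inequality for the merged block
    have hWulff : 3 * (volume K).toReal ^ ((1 : ℝ) / 3) *
        (volume (⋃ f ∈ Finset.univ.filter (fun f => blk f = b), G f)).toReal ^ ((2 : ℝ) / 3) ≤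
        per K (⋃ f ∈ Finset.univ.filter (fun f => blk f = b), G f) :=
      wulff_le_per (hBc b) (hBv b) (hB0 b) ⟨(hfacts b).1, lt_top_iff_ne_top.2 (hfacts b).2.2.1⟩
        (hfacts b).2.1
    -- the over-count of the interfaces of the merged block
    have hover : (∑ g ∈ Finset.univ \ Finset.univ.filter (fun f => blk f = b),
        (per K (⋃ f ∈ Finset.univ.filter (fun f => blk f = b), G f) + per K (G g) -
          per K ((⋃ f ∈ Finset.univ.filter (fun f => blk f = b), G f) ∪ G g)) / 2) ≤
        ∑ f ∈ Finset.univ.filter (fun f => blk f = b),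
          ∑ g, (if blk g = blk f then 0 else R (blk f) * w f g) := by
      have hadd : ∀ g ∈ Finset.univ \ Finset.univ.filter (fun f => blk f = b),
          (per K (⋃ f ∈ Finset.univ.filter (fun f => blk f = b), G f) + per K (G g) -
            per K ((⋃ f ∈ Finset.univ.filter (fun f => blk f = b), G f) ∪ G g)) / 2 ≤
          ∑ f ∈ Finset.univ.filter (fun f => blk f = b), R b * w f g := by
        intro g hg
        have hg' : g ∉ Finset.univ.filter (fun f => blk f = b) := (Finset.mem_sdiff.1 hg).2
        have hbg : blk g ≠ b := fun h => hg' (Finset.mem_filter.2 ⟨Finset.mem_univ g, h⟩)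
        rw [two_iota_biUnion_left G hPoly hvol hdisjG (hBc b) (hBv b) (hB0 b) (hBs b) hg',
          Finset.sum_div]
        refine Finset.sum_le_sum fun f hf => ?_
        have hbf : blk f = b := (Finset.mem_filter.1 hf).2
        have hfg : f ≠ g := fun h => hbg (h ▸ hbf)
        have hle := hιle b f g hfg
        simp only [hw, hfg, if_false]
        have hR0 : (0 : ℝ) ≤ R b := (hR b).le
        nlinarith
      refine (Finset.sum_le_sum hadd).trans (le_of_eq ?_)
      rw [Finset.sum_comm]
      refine Finset.sum_congr rfl fun f hf => ?_
      have hbf : blk f = b := (Finset.mem_filter.1 hf).2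
      rw [← Finset.filter_not, Finset.sum_filter]
      refine Finset.sum_congr rfl fun g _ => ?_
      rw [hbf]
      by_cases h : blk g = b
      · rw [if_pos h, if_neg (not_not.2 h)]
      · rw [if_neg h, if_pos h]
    linarith
  -- sum over the blocks
  have hsum := Finset.sum_le_sum hblock
  have e1 : (∑ b ∈ L, ∑ f ∈ Finset.univ.filter (fun f => blk f = b),
      ∑ g, (if blk g = blk f then 0 else R (blk f) * w f g)) =
      ∑ f, ∑ g, (if blk g = blk f then 0 else R (blk f) * w f g) :=
    Finset.sum_fiberwise_of_maps_to hmaps _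
  have e2 : (∑ b ∈ L, ∑ f ∈ Finset.univ.filter (fun f => blk f = b),
      (per (Kf' f) (G f) - ∑ g, (if f = g then 0 else
        (per (Kf' f) (G f) + per (Kf' f) (G g) - per (Kf' f) (G f ∪ G g)) / 2))) =
      ∑ f, (per (Kf' f) (G f) - ∑ g, (if f = g then 0 else
        (per (Kf' f) (G f) + per (Kf' f) (G g) - per (Kf' f) (G f ∪ G g)) / 2)) :=
    Finset.sum_fiberwise_of_maps_to hmaps _
  rw [Finset.sum_sub_distrib, e1, e2] at hsum
  have hw' : ∀ f g, (if blk g = blk f then 0 else R (blk f) * w f g) =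
      (if blk g = blk f then 0 else R (blk f) *
        ((per (closedBall (0 : E3) 1) (G f) + per (closedBall (0 : E3) 1) (G g) -
          per (closedBall (0 : E3) 1) (G f ∪ G g)) / 2)) := by
    intro f g
    by_cases h : blk g = blk f
    · rw [if_pos h, if_pos h]
    · have hfg : f ≠ g := fun h' => h (h' ▸ rfl)
      rw [if_neg h, if_neg h]
      simp only [hw, hfg, if_false]
  simp_rw [hw'] at hsum
  exact hsum

end Summit.Ventures.Crystal3D.Theorems

end
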